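/-
Origin: expansion seat `planner-pub-hodgecm-mc-axioms-1-g14-0`, handover #W182 2026-08-20T15:53:55Z md5 5fa0bb5f1977 (PKG 7de74523df5c → 5fa0bb5f1977; 422 l.; MECHANICAL (iib-R) rewrite v3.1 of the PKG file as it stands (63 token edits; rules R1x2+RX[h₂']x61)) (`HOME/mc/pub-hodgecm-mc-axioms-1-g14/revendor/kit-r55/stage55/HodgeCM/Model/Sanity/PinThetaCollapse.lean`, md5 5fa0bb5f1977, 422 lines);
landed by the gen-22 packager (p-g22) in gate run 55 REPLACES the earlier landed copy of `HodgeCM/Model/Sanity/PinThetaCollapse.lean` (seat copy carried the packager Origin header of an earlier run (stripped)).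
-/
/-
Origin: SANITY lane `planner-pub-hodgecm-mc-sanity-1-g8-0` (unit pub-hodgecm-mc-sanity-1-g8, gen 8 of mc-sanity-1),
2026-08-19 — (Θ-sat) MECHANICAL RE-STAGE of the installed RUN-35 leaf (PKG md5 a29db23c7cb0, M5″, 405 l.) over
mc-theta-3's RUN-37 packet (`Model/ThetaSpaceSat` NEW; `Model/ThetaClassInputInstance` (Θ-sat): `X.Θ k Γ :=
thetaSpaceSatOf … (X.KΓ Γ) …` ≤ the v2 space `thetaSpaceOf …`, `ThetaSpaceInput.Θ_le_thetaSpaceOf`).  Delta =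
exactly ONE proof hunk, § 2 `Θ_thetaSpaceInputIn_eq_bot`: the goal `X.Θ k Γ = ⊥` now unfolds to the SATURATED space,
so the v2 term (a proof of `thetaSpaceOf … = ⊥`) is composed with `Θ_le_thetaSpaceOf` (`eq_bot_iff.2 <| (…).trans
(…).le`).  Every statement and every other byte is unchanged; verdicts unchanged (the saturated theta space of the pin
over an archimedean-trivial side is a fortiori `⊥`).  Install AFTER theta-3's (Θ-sat) `ThetaClassInputInstance` and
its RUN-37 `ThetaSpaceInputPin` (which supplies the pin's new field `KΓ`); rides RUN 37 with that packet, never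
stand-alone.  Author rehearsal: private overlay over the theta-3-g8 drafts + a `KΓ := ⊥` stand-in pin, rc 0, 0 warnings.
-/
/-
Origin: SANITY lane `planner-pub-hodgecm-mc-sanity-1-g5-0` (unit pub-hodgecm-mc-sanity-1-g5, gen 5 of mc-sanity-1,
node SAN-11), 2026-08-19.  v2 RE-CUT for the coordinated RUN-34 «level-free ιinf + arch × fin splitting» revision of
`HodgeCM.Model.ThetaSpaceInputPin` (mc-theta-3-g3 v2 candidate 5a6bf8038289) and `HodgeCM.Model.ThetaSpaceInputPinRigidity`
(v2 candidate 308a82655361): SUPERSEDES the RUN-33 bytes 9ec9c8d37ad4 (gen 4; installed as 041b7e8d88bb) of this same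
path — whole-file replacement, same 31 declaration names; delta = the hypotheses `hι` of § 2 / § 4 lose their `Level`
binder (`∀ x : U(2,1), (S V c).ιinf x = 1`).  Imports SAN-10a v2 `HodgeCM.Model.Sanity.ThetaAdelicSideDegenerate`
(this seat), theta-3's v2 #9, mc-sanity-1-g3 `Sanity/ThetaClassesDegenerate` (RUN 33 CUT #1) and the PACKAGE modules
`HodgeCM.Model.ThetaModelExists`, `HodgeCM.PerL34.ThetaSubOfLiu`; nothing imports it.  Install AFTER theta-3 v2 #9 and
SAN-10a v2.  KERNEL: 0 records, 0 hypotheses minted, 0 `Prop` definitions, no global instances, nothing cited.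
Expected `#print axioms`: ⊆ {propext, Classical.choice, Quot.sound}.
-/
import Summits.HodgeConjecture.HodgeCM.Model.Sanity.ThetaAdelicSideDegenerate
import Summits.HodgeConjecture.HodgeCM.Model.Sanity.ThetaClassesDegenerate
import Summits.HodgeConjecture.HodgeCM.Model.ThetaSpaceInputPinRigidity
import Summits.HodgeConjecture.HodgeCM.Model.ThetaModelExists
import Summits.HodgeConjecture.HodgeCM.PerL34.ThetaSubOfLiu_2

/-!
# SAN-11: over an archimedean-trivial adelic side the pinned theta sets COLLAPSE to `{0}` —
# a kernel profile of every `Θ`-quantified binder of E (R9 and the stage-1 bodies)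

SAN-10 profiled the DATA binder `S : ThetaAdelicSide V c` of E's revision R9 (`Model/E2InstanceR9`,
`perL_picardCM_r9`) and its socket `C` (SAN-10a: `S` alone is free — `degS`; SAN-10b with mc-theta-3-g3 #8/#9: `C` is
EMPTY over every `S` whose archimedean component is trivial on the stabiliser).  This leaf profiles what the OTHER
theta-side binders of R9 — `thetaSat`, `transl`, `hLiu` — and the stage-1 / `Open_*` bodies (`ThetaSubAt`,
`ThetaWedgeAt`, `Gen12MeetAt`, `ThetaGen12AllAt`, `ThetaReal34At`, the function-level bridge `Gen12FunBridge`) are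
worth over such an `S`.  They all quantify over the theta sets

  `(thetaModelOf … (thetaOf _ (thetaClassInputOf _ fun V c => thetaSpaceInputOf hHD hI h₁ h₂ h₃ S V c)) …).Theta V c i Γ`

of the pin (mc-theta-3-g3 #6 `Model/ThetaSpaceInputPin`), and the point of this file is the kernel theorem

  **`thetaOf_pin_eq`**: if `(S V c).ιinf = 1` (pointwise; v2: `ιinf` is level-free) then that theta set is `{0}` — at every context, type
  index and level, in BOTH branches of the pin (`thetaOf_pin_degS` for SAN-10a's `degS`).

* § 1 (generic, vendored-API level) `eq_zero_of_mem_weightForms_of_const`: a CONSTANT classical weight form is `0`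
  once the weight `τ₁` has no non-zero invariant vector; hence restriction along a trivial archimedean inclusion is the
  zero map (`restrictHom_eq_zero_of_trivial`), the classical theta space `thetaSpaceOf P ιinf Δ κ₁ τ₁ 𝓕` is `⊥`
  (`thetaSpaceOf_eq_bot_of_trivial`), and through a class-map datum with injective `pull` the theta classes of `⊥` are
  `{0}` (`thetaClasses_bot_of_injective`).
* § 2 (the pin) `Θ_thetaSpaceInputIn_eq_bot` (regime branch; the rigidity of `weightOf x₀` is theta-3 #9's
  `thetaSpaceInputIn_tau_rigid`, the injectivity is the package's `classMapDatumOf_pull_injective`), `thetaOf_pin_eq`,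
  `thetaOf_pin_degS`; the off-regime branch is theta-3's `thetaOf_thetaSpaceInputOf_of_not_isAnisotropic`.
* § 3 (any COLLAPSED theta model `T`, i.e. `T.Theta V c i Γ = {0}` for all `i, Γ` — over ANY universe) the profile:
  `thetaSat`-shape FREE (`pullC_mem_theta_of_collapse`), `thetaSub`/`ThetaSubAt` FREE (`thetaSubAt_of_collapse`),
  `hLiu`-shape FREE in a good context (`hLiu_of_collapse`: `M := L`, `k :=` the forced embedding, `σ' := ι₁`),
  `transl`-shape FREE for any ball data with `ev Γ 0 = 0` (`transl_of_collapse`), cup products and wedge-functions of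
  theta one-forms VANISH (`cup2C_eq_zero_of_collapse`, `Λ_eq_zero_of_collapse`, `wedgeSet_subset_of_collapse`), so
  `ThetaWedgeAt` is REFUTED (`not_thetaWedgeAt_of_collapse`), `Gen12MeetAt` and `ThetaGen12AllAt` are VACUOUS
  (`gen12MeetAt_of_collapse`, `thetaGen12AllAt_of_collapse`), a `Gen12FunBridge` costs exactly one character index and
  one Schwartz datum (`gen12FunBridgeOfCollapse`), and `ThetaReal34At` BECOMES the vanishing of every allowed
  `(34)`-theta lift (`thetaReal34At_iff_of_collapse`) — the content migrates, undiminished, to the W-side.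
* § 4 (E's instance) the pin over an archimedean-trivial `S` IS collapsed (`theta_thetaModelOf_pin_eq`,
  `theta_thetaModelOf_degS_eq`, for every `h, emb, cover, wm, d12, d34`), the model ball data has `ev Γ 0 = 0`
  (`ballOf_ev_zero`), and the R9-shaped headline `transl_degS`.

VERDICT for carvers (MODEL-N += 0; details `mc/pub-hodgecm-mc-sanity-1-g4/SANITY.md` § SAN-11, v13 in `…-g5/SANITY.md`): at an
archimedean-trivial `S` EVERY `Θ`-quantified `Prop` binder of E is decided at the zero class — `thetaSat`, `transl`,
`thetaSub`, `hLiu`, `Gen12MeetAt`, `ThetaGen12AllAt` hold for free, `ThetaWedgeAt` fails, `ThetaReal34At` turns into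
`ϑ₃₄ ≡ 0` on allowed characters — while the socket `C` is empty (SAN-10b).  So the binder list of R9 is NOT jointly
cheap, and its theta-side content sits exactly in (`S` honest) + `C` (+ `hol`), with `real34`, `hyp12`, `hyp34`
`Θ`-free (W/μ-side, not profiled here).  Nothing here is evidence about PerL's mathematics.
-/

set_option autoImplicit false

noncomputable section

open MulAction
open HodgeCM.Model.ThetaSpace
open Literature.Geometry.ComplexHyperbolic.BallModel (U21 Ball x₀)
open Literature.NumberTheory.Automorphic Literature.NumberTheory.Automorphic.WeightForms Literature.NumberTheory.Weil1964
open Literature.AlgebraicGeometry.HodgeTheory Literature.AlgebraicGeometry.ShimuraVarieties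
open Literature.NumberTheory.Automorphic.PicardCM
open HodgeCM.Model.SupplyInstance HodgeCM.Model.SupplyResidual
open scoped SchwartzMap Classical Matrix

namespace HodgeCM
namespace Model
namespace Sanity

/-! ## § 1  Generic: constant weight forms, trivial restriction, theta classes of `⊥` -/

section Generic

variable {GU : Type*} [Group GU] {Kc : Type*} [Group Kc] {ΓU : Subgroup GU} {κ : Kc →* GU}
  {W : Type*} [AddCommGroup W] [Module ℂ W] {τ : Representation ℂ Kc W}
  {G₁ : Type*} [Group G₁] {K₁ : Type*} [Group K₁] (ι : G₁ →* GU) {Δ : Subgroup G₁} {κ₁ : K₁ →* G₁}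
  {τ₁ : Representation ℂ K₁ W} (hΔ : IsLevelCorrected ΓU κ τ ι Δ) {η₁ : K₁ →* Kc}
  (hη : IsWeightMatched κ τ ι κ₁ τ₁ η₁)

/-- A CONSTANT classical weight form is zero as soon as the weight has no non-zero invariant vector. -/
theorem eq_zero_of_mem_weightForms_of_const (hτ : ∀ w : W, (∀ u : K₁, τ₁ u w = w) → w = 0)
    {f : G₁ → W} (hf : f ∈ weightForms Δ κ₁ τ₁) (hc : ∀ x y : G₁, f x = f y) : f = 0 := by
  have h1 : f 1 = 0 := hτ (f 1) fun u => by
    have h := WeightForms.apply_right_equiv hf u 1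
    rwa [hc (1 * κ₁ u) 1] at h
  funext x
  rw [hc x 1, h1, Pi.zero_apply]

/-- Restriction along an archimedean inclusion that is TRIVIAL (`ι x = 1`) kills every adelic form, as soon as the
classical weight `τ₁` is rigid. -/
theorem restrictHom_apply_eq_zero_of_trivial (hι : ∀ x : G₁, ι x = 1)
    (hτ : ∀ w : W, (∀ u : K₁, τ₁ u w = w) → w = 0) (F : weightForms ΓU κ τ) : restrictHom ι hΔ hη F = 0 := by
  apply Subtype.ext
  refine eq_zero_of_mem_weightForms_of_const hτ (restrictHom ι hΔ hη F).2 fun x y => ?_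
  rw [restrictHom_apply, restrictHom_apply, hι x, hι y]

/-- (Ported verbatim from the HodgeCMPerL package; no docstring in the source.) -/
theorem restrictHom_eq_zero_of_trivial (hι : ∀ x : G₁, ι x = 1)
    (hτ : ∀ w : W, (∀ u : K₁, τ₁ u w = w) → w = 0) : restrictHom ι hΔ hη = 0 :=
  LinearMap.ext (restrictHom_apply_eq_zero_of_trivial ι hΔ hη hι hτ)

/- (RUN 33 CUT #2 pre-build bounce, p-g9 02:01Z) `thetaClasses_bot_of_injective` is NOT re-declared here: it is
mc-sanity-1-g3's `HodgeCM.Model.Sanity.thetaClasses_bot_of_injective` (`Sanity/ThetaClassesDegenerate.lean` § 3,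
CUT #1, built GREEN), now imported. -/

end Generic

section ThetaSpace

variable {K L : Type} [Field K] [NumberField K] [Field L] [NumberField L] [Algebra K L] [FiniteDimensional K L]
variable {J : Type} [Fintype J] {GU : Type} [Group GU] [TopologicalSpace GU] [IsTopologicalGroup GU]
  [LocallyCompactSpace GU]
variable (P : WeilPairData K L J GU) [hP : CompactSpace (GU ⧸ P.ΓU)]
variable {G₁ K₁ W : Type} [Group G₁] [Group K₁] [AddCommGroup W] [Module ℂ W] [Module.IsReflexive ℂ W]
variable (ιinf : G₁ →* GU) (Δ : Subgroup G₁) (κ₁ : K₁ →* G₁) (τ₁ : Representation ℂ K₁ W)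

/-- **The classical theta space along a TRIVIAL archimedean inclusion is zero** (rigid weight): every restricted
adelic theta form is constant, hence `0`. -/
theorem thetaSpaceOf_eq_bot_of_trivial (hι : ∀ x : G₁, ιinf x = 1)
    (hτ : ∀ w : W, (∀ u : K₁, τ₁ u w = w) → w = 0)
    (𝓕 : Set C(relNormOneIdeles K L ⧸ relNormOneRat K L, ℂ)) : thetaSpaceOf P ιinf Δ κ₁ τ₁ 𝓕 = ⊥ := by
  rw [eq_bot_iff, thetaSpaceOf_le_iff]
  intro S f hf
  obtain ⟨F, -, rfl⟩ := Submodule.mem_map.1 hf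
  rw [Submodule.mem_bot]
  exact restrictHom_apply_eq_zero_of_trivial ιinf S.hΔ S.hη hι hτ F

end ThetaSpace

/-! ## § 2  The pin over an archimedean-trivial side: `Θ_k(Γ) = ⊥`, `thetaOf = {0}` -/

section Pin

variable (hHD : exists_isReal_hodgeModel) (hI : hodgePQ_independent_of_hodgeModel)
  (h₁ : BallQuotientUniformised)  (h₃ : CMAbelianVarietyRealised)

variable {L : CMField} {ι₁ : L →+* ℂ} {V : HermSpace3 L ι₁} {c : SeesawCtx L}

/-- **Regime branch: the classical theta space of the pin is `⊥` over an archimedean-trivial side** (any `ω`). -/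
theorem Θ_thetaSpaceInputIn_eq_bot (Sv : ThetaAdelicSide V c) (hV : IsAnisotropic L V.Hm) (k : Fin 4)
    (Γ : Level V) (hι : ∀ x : U21, Sv.ιinf x = 1) :
    (thetaSpaceInputIn hHD hI h₁ h₃ Sv hV).Θ k Γ = ⊥ :=
  eq_bot_iff.2 <| ((thetaSpaceInputIn hHD hI h₁ h₃ Sv hV).Θ_le_thetaSpaceOf k Γ).trans
    (thetaSpaceOf_eq_bot_of_trivial (hP := (thetaSpaceInputIn hHD hI h₁ h₃ Sv hV).instCompact k) _ _ _ _ _ hι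
      (thetaSpaceInputIn_tau_rigid hHD hI h₁ h₃ Sv hV) _).le

/-- … hence the END STATE's `Θ_k(Γ)` over the pin is `{0}` in the regime branch … -/
theorem thetaOf_pin_eq_of_isAnisotropic
    (S : ∀ {L : CMField} {ι₁ : L →+* ℂ} (V : HermSpace3 L ι₁) (c : SeesawCtx L), ThetaAdelicSide V c)
    (V : HermSpace3 L ι₁) (c : SeesawCtx L) (k : Fin 4) (Γ : Level V) (hV : IsAnisotropic L V.Hm)
    (hι : ∀ x : U21, (S V c).ιinf x = 1) :
    thetaOf _ (thetaClassInputOf _ (fun V c => thetaSpaceInputOf hHD hI h₁ h₃ S V c)) V c k Γ = {0} := by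
  rw [thetaOf_thetaSpaceInputOf_of_isAnisotropic hHD hI h₁ h₃ S V c k Γ hV,
    Θ_thetaSpaceInputIn_eq_bot hHD hI h₁ h₃ (S V c) hV k Γ hι, thetaSpaceInputIn_D]
  exact thetaClasses_bot_of_injective _ _ (classMapDatumOf_pull_injective ..)

/-- **… and in both branches.** -/
theorem thetaOf_pin_eq
    (S : ∀ {L : CMField} {ι₁ : L →+* ℂ} (V : HermSpace3 L ι₁) (c : SeesawCtx L), ThetaAdelicSide V c)
    (V : HermSpace3 L ι₁) (c : SeesawCtx L) (k : Fin 4) (Γ : Level V)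
    (hι : ∀ x : U21, (S V c).ιinf x = 1) :
    thetaOf _ (thetaClassInputOf _ (fun V c => thetaSpaceInputOf hHD hI h₁ h₃ S V c)) V c k Γ = {0} := by
  by_cases hV : IsAnisotropic L V.Hm
  · exact thetaOf_pin_eq_of_isAnisotropic hHD hI h₁ h₃ S V c k Γ hV hι
  · exact thetaOf_thetaSpaceInputOf_of_not_isAnisotropic hHD hI h₁ h₃ S V c k Γ hV

/-- Over `degS` (SAN-10a): `Θ_k(Γ) = {0}` at every context, type index and level. -/
theorem thetaOf_pin_degS (V : HermSpace3 L ι₁) (c : SeesawCtx L) (k : Fin 4) (Γ : Level V) :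
    thetaOf _ (thetaClassInputOf _ (fun V c => thetaSpaceInputOf hHD hI h₁ h₃ degS V c)) V c k Γ = {0} :=
  thetaOf_pin_eq hHD hI h₁ h₃ degS V c k Γ fun x => by rw [degS_ιinf, MonoidHom.one_apply]


end Pin

/-! ## § 3  Collapsed theta models (`Theta ≡ {0}`, any universe): every `Θ`-quantified binder profiled -/

section Collapse

open HodgeCM.Universe (ThetaModel BallData)
open HodgeCM.CMTypeOps (inflate)
open Literature.AlgebraicGeometry.Motives (CMType)
open scoped InnerProductSpace

variable {U : Universe} (T : U.ThetaModel) {L : CMField} {ι₁ : L →+* ℂ} (V : HermSpace3 L ι₁) (c : SeesawCtx L)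
  (hT : ∀ (i : Fin 4) (Γ : Level V), T.Theta V c i Γ = {0})
include hT

/-- (Ported verbatim from the HodgeCMPerL package; no docstring in the source.) -/
theorem mem_theta_iff_of_collapse {i : Fin 4} {Γ : Level V} {ω : U.CohC (U.pms L ι₁ V Γ) 1} :
    ω ∈ T.Theta V c i Γ ↔ ω = 0 := by
  rw [hT, Set.mem_singleton_iff]

/-- `thetaSat`-shape (saturation under ANY pull-back) is FREE over a collapsed model. -/
theorem pullC_mem_theta_of_collapse {i : Fin 4} {Γ Γ' : Level V} (φ : U.Mor (U.pms L ι₁ V Γ') (U.pms L ι₁ V Γ))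
    {ω : U.CohC (U.pms L ι₁ V Γ) 1} (hω : ω ∈ T.Theta V c i Γ) : U.pullC φ 1 ω ∈ T.Theta V c i Γ' := by
  rw [mem_theta_iff_of_collapse T V c hT] at hω ⊢
  rw [hω, map_zero]

/-- `thetaSub` / `hLiu`-inclusion shape is FREE: `Θ_i(Γ) ⊆ U_Ψ(Γ; M, Ψ, σ)` for ANY `(M, Ψ, σ)`. -/
theorem theta_subset_Uiso_of_collapse (i : Fin 4) (Γ : Level V) (M : CMField) (Ψ : CMType M) (σ : M →+* ℂ) :
    T.Theta V c i Γ ⊆ U.Uiso Γ M Ψ σ := by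
  rw [hT]
  exact Set.singleton_subset_iff.2 (Submodule.zero_mem _)

/-- (Ported verbatim from the HodgeCMPerL package; no docstring in the source.) -/
theorem thetaSubAt_of_collapse : T.ThetaSubAt V c := fun i Γ =>
  theta_subset_Uiso_of_collapse T V c hT i Γ _ _ _

/-- `hLiu`-shape is FREE in a good context: `M := L`, `k :=` the forced embedding, `σ' := ι₁`. -/
theorem hLiu_of_collapse (hc : T.GoodCtx ι₁ c) (i : Fin 4) (Γ : Level V) :
    ∃ (M : CMField) (k : c.K →+* M) (σ' : M →+* ℂ), σ'.comp k = c.σ ∧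
      T.Theta V c i Γ ⊆ U.Uiso Γ M (inflate k (c.Ψ i)) σ' := by
  obtain ⟨j, hj, -⟩ := hc.forced
  exact ⟨L, j, ι₁, hj, theta_subset_Uiso_of_collapse T V c hT i Γ L _ ι₁⟩

/-- `transl`-shape is FREE for any ball data whose class evaluation vanishes at the zero class. -/
theorem transl_of_collapse (B : U.BallData V c) (hB : ∀ Γ : Level V, B.ev Γ 0 = 0) (γ : B.Gr) (i : Fin 4)
    (Γ : Level V) (ω : U.CohC (U.pms L ι₁ V Γ) 1) (hω : ω ∈ T.Theta V c i Γ) :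
    ∃ (Γ' : Level V) (ω' : U.CohC (U.pms L ι₁ V Γ') 1), ω' ∈ T.Theta V c i Γ' ∧
      B.ev Γ' ω' = fun x => B.J γ x *ᵥ B.ev Γ ω (γ • x) := by
  rw [mem_theta_iff_of_collapse T V c hT] at hω
  subst hω
  refine ⟨Γ, 0, (mem_theta_iff_of_collapse T V c hT).2 rfl, ?_⟩
  funext x
  rw [hB, Pi.zero_apply, Pi.zero_apply, Matrix.mulVec_zero]

/-- The cup product of two theta one-forms VANISHES over a collapsed model … -/
theorem cup2C_eq_zero_of_collapse {k : Fin 4} {Γ : Level V} {ω₁ : U.CohC (U.pms L ι₁ V Γ) 1}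
    (h₁ : ω₁ ∈ T.Theta V c k Γ) (ω₂ : U.CohC (U.pms L ι₁ V Γ) 1) : U.cup2C (U.pms L ι₁ V Γ) 1 ω₁ ω₂ = 0 := by
  rw [mem_theta_iff_of_collapse T V c hT] at h₁
  rw [h₁, map_zero, LinearMap.zero_apply]

/-- … so the model's wedge-function `Λ_Γ(ω₁, ω₂)` vanishes, … -/
theorem Λ_eq_zero_of_collapse {k l : Fin 4} {Γ : Level V} {ω₁ ω₂ : U.CohC (U.pms L ι₁ V Γ) 1}
    (h₁ : ω₁ ∈ T.Theta V c k Γ) (_h₂ : ω₂ ∈ T.Theta V c l Γ) : T.Λ Γ ω₁ ω₂ = 0 := by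
  rw [ThetaModel.Λ_apply, cup2C_eq_zero_of_collapse T V c hT h₁ ω₂, map_zero]

/-- … the generating set of PerL Lemma 3.5 collapses, … -/
theorem wedgeSet_subset_of_collapse (k l : Fin 4) : T.wedgeSet V c k l ⊆ {0} := by
  rintro x ⟨Γ, ω, hω, ω', hω', rfl⟩
  exact Λ_eq_zero_of_collapse T V c hT hω hω'

/-- … the `thetaWedge`-shape (stage-1 binder / `Open_thetaWedge` body) is REFUTED, … -/
theorem not_thetaWedgeAt_of_collapse : ¬ T.ThetaWedgeAt V c := by
  rintro ⟨Γ, ω₁, h₁, ω₂, -, hne⟩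
  exact hne (cup2C_eq_zero_of_collapse T V c hT h₁ ω₂)

/-- … the C5′ meeting statement `Gen12MeetAt` (consumer of `gen12`) is VACUOUSLY TRUE, … -/
theorem gen12MeetAt_of_collapse : T.Gen12MeetAt V c := fun _ _ _ h₁ h₂ hne =>
  absurd (Λ_eq_zero_of_collapse T V c hT h₁ h₂) hne

/-- … the `Open_thetaGen12All` body is FREE, … -/
theorem thetaGen12AllAt_of_collapse : T.ThetaGen12AllAt V c := fun Γ ω₁ ω₂ h₁ h₂ => by
  rw [Λ_eq_zero_of_collapse T V c hT h₁ h₂]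
  exact Submodule.zero_mem _

/-- … the function-level (12)-bridge `gen12` costs exactly ONE character index and ONE Schwartz datum, … -/
def gen12FunBridgeOfCollapse (χ₀ : (T.t12 V c).X) (Φ₀ : T.SK V c) : T.Gen12FunBridge V c where
  wf _ _ _ := (T.t12 V c).ϑ χ₀ Φ₀
  wf_gen _ _ _ _ _ := ⟨χ₀, Φ₀, rfl⟩
  proj Γ ω₁ ω₂ h₁ h₂ := ⟨1, one_ne_zero, by
    rw [Λ_eq_zero_of_collapse T V c hT h₁ h₂, inner_zero_left, inner_zero_left, mul_zero]⟩

/-- … and the `Open_thetaReal34` body turns into the VANISHING of every allowed `(34)`-theta lift — the content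
migrates, undiminished, to the W-side. -/
theorem thetaReal34At_iff_of_collapse :
    T.ThetaReal34At V c ↔ ∀ χ : (T.t34 V c).X, (T.t34 V c).allowed χ → ∀ Φ : T.SK V c, (T.t34 V c).ϑ χ Φ = 0 := by
  have hspan : (Submodule.span ℂ (T.wedgeSet V c 2 3)).topologicalClosure = ⊥ := by
    refine le_bot_iff.1 (Submodule.topologicalClosure_minimal _ ?_ ?_)
    · exact Submodule.span_le.2 ((wedgeSet_subset_of_collapse T V c hT 2 3).trans (by simp))
    · rw [Submodule.bot_coe]
      exact isClosed_singleton
  refine ⟨fun h χ hχ Φ => ?_, fun h χ hχ Φ => ?_⟩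
  · have hm := h χ hχ Φ
    rwa [hspan, Submodule.mem_bot] at hm
  · rw [h χ hχ Φ]
    exact Submodule.zero_mem _

end Collapse

/-! ## § 4  E's instance: the pinned model over an archimedean-trivial `S` is collapsed; R9-shaped headlines -/

section PinCollapse

open HodgeCM.Universe (SideData ThetaModel)

variable (hHD : exists_isReal_hodgeModel) (hI : hodgePQ_independent_of_hodgeModel)
  (h₁ : BallQuotientUniformised)  (h₃ : CMAbelianVarietyRealised)

/-- (Ported verbatim from the HodgeCMPerL package; no docstring in the source.) -/
theorem theta_thetaModelOf_pin_eq
    (S : ∀ {L : CMField} {ι₁ : L →+* ℂ} (V : HermSpace3 L ι₁) (c : SeesawCtx L), ThetaAdelicSide V c)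
    (hι : ∀ {L : CMField} {ι₁ : L →+* ℂ} (V : HermSpace3 L ι₁) (c : SeesawCtx L) (x : U21),
      (S V c).ιinf x = 1)
    (h : Bool) (emb) (cover) (wm) (d12 d34 : ∀ {L : CMField}, SeesawCtx L → SideData L)
    {L : CMField} {ι₁ : L →+* ℂ} (V : HermSpace3 L ι₁) (c : SeesawCtx L) (i : Fin 4) (Γ : Level V) :
    (thetaModelOf hHD hI h₁ h₃ h emb cover wm
      (thetaOf _ (thetaClassInputOf _ (fun V c => thetaSpaceInputOf hHD hI h₁ h₃ S V c))) d12 d34).Theta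
        V c i Γ = {0} :=
  thetaOf_pin_eq hHD hI h₁ h₃ S V c i Γ (hι V c)

/-- (Ported verbatim from the HodgeCMPerL package; no docstring in the source.) -/
theorem theta_thetaModelOf_degS_eq (h : Bool) (emb) (cover) (wm) (d12 d34 : ∀ {L : CMField}, SeesawCtx L → SideData L)
    {L : CMField} {ι₁ : L →+* ℂ} (V : HermSpace3 L ι₁) (c : SeesawCtx L) (i : Fin 4) (Γ : Level V) :
    (thetaModelOf hHD hI h₁ h₃ h emb cover wm
      (thetaOf _ (thetaClassInputOf _ (fun V c => thetaSpaceInputOf hHD hI h₁ h₃ degS V c))) d12 d34).Theta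
        V c i Γ = {0} :=
  thetaOf_pin_degS hHD hI h₁ h₃ V c i Γ

/-- The ball data's class evaluation is linear, so vanishes at `0`. -/
theorem ballOf_ev_zero {L : CMField} {ι₁ : L →+* ℂ} (V : HermSpace3 L ι₁) (c : SeesawCtx L)
    (hL : 2 < Module.finrank ℚ L) (Γ : Level V) : (ballOf hHD hI h₁ h₃ V c hL).ev Γ 0 = 0 := by
  rw [ballOf_ev]
  exact LinearMap.map_zero (R := ℂ) (S := ℂ) (M₃ := Ball → Fin 2 → ℂ) _

variable (h : Bool)
  (emb : ∀ {L : CMField} {ι₁ : L →+* ℂ} {V : HermSpace3 L ι₁} (Γ : Level V),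
    (picardCMUniverse hHD hI h₁ h₃).CohC ((picardCMUniverse hHD hI h₁ h₃).pms L ι₁ V Γ) 2 →ₗ[ℂ]
      (V.latticeModel printFact_unitaryCompact_holds).toQuotientModel.H)
  (cover : ∀ {L : CMField} {ι₁ : L →+* ℂ} {V : HermSpace3 L ι₁} (Γ Γ' : Level V),
    Γ'.Γ ≤ Γ.Γ → (picardCMUniverse hHD hI h₁ h₃).Mor ((picardCMUniverse hHD hI h₁ h₃).pms L ι₁ V Γ')
      ((picardCMUniverse hHD hI h₁ h₃).pms L ι₁ V Γ))
  (wm : ∀ {L : CMField} {ι₁ : L →+* ℂ} (V : HermSpace3 L ι₁) (c : SeesawCtx L),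
    WeilThetaModel (V.latticeModel printFact_unitaryCompact_holds).toQuotientModel.G
      (V.latticeModel printFact_unitaryCompact_holds).toQuotientModel.Γ
      (c.D.latticeModelW printFact_unitaryCompact_holds).toQuotientModel.G
      (c.D.latticeModelW printFact_unitaryCompact_holds).toQuotientModel.Γ)
  (d12 d34 : ∀ {L : CMField}, SeesawCtx L → SideData L)

/-- **Headline 1 (R9's `thetaSat` over `degS`, any cover).** -/
theorem thetaSat_degS {L : CMField} {ι₁ : L →+* ℂ} (V : HermSpace3 L ι₁) (c : SeesawCtx L) (i : Fin 4)
    (Γ Γ' : Level V) (hle : Γ'.Γ ≤ Γ.Γ)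
    (ω : (picardCMUniverse hHD hI h₁ h₃).CohC ((picardCMUniverse hHD hI h₁ h₃).pms L ι₁ V Γ) 1)
    (hω : ω ∈ (thetaModelOf hHD hI h₁ h₃ h emb cover wm
      (thetaOf _ (thetaClassInputOf _ (fun V c => thetaSpaceInputOf hHD hI h₁ h₃ degS V c))) d12 d34).Theta
        V c i Γ) :
    (picardCMUniverse hHD hI h₁ h₃).pullC (cover Γ Γ' hle) 1 ω ∈ (thetaModelOf hHD hI h₁ h₃ h emb cover wm
      (thetaOf _ (thetaClassInputOf _ (fun V c => thetaSpaceInputOf hHD hI h₁ h₃ degS V c))) d12 d34).Theta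
        V c i Γ' :=
  pullC_mem_theta_of_collapse _ V c (theta_thetaModelOf_degS_eq hHD hI h₁ h₃ h emb cover wm d12 d34 V c) _ hω

/-- **Headline 2 (R9's `transl` over `degS`, the model ball data at any regime proof `hL`).** -/
theorem transl_degS {L : CMField} {ι₁ : L →+* ℂ} (V : HermSpace3 L ι₁) (c : SeesawCtx L)
    (hL : 2 < Module.finrank ℚ L) :
    ∀ γ ∈ (ballOf hHD hI h₁ h₃ V c hL).Δ, ∀ (i : Fin 4) (Γ : Level V)
      (ω : (picardCMUniverse hHD hI h₁ h₃).CohC ((picardCMUniverse hHD hI h₁ h₃).pms L ι₁ V Γ) 1),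
      ω ∈ (thetaModelOf hHD hI h₁ h₃ h emb cover wm
        (thetaOf _ (thetaClassInputOf _ (fun V c => thetaSpaceInputOf hHD hI h₁ h₃ degS V c))) d12 d34).Theta
          V c i Γ →
      ∃ (Γ' : Level V) (ω' : (picardCMUniverse hHD hI h₁ h₃).CohC
          ((picardCMUniverse hHD hI h₁ h₃).pms L ι₁ V Γ') 1),
        ω' ∈ (thetaModelOf hHD hI h₁ h₃ h emb cover wm
          (thetaOf _ (thetaClassInputOf _ (fun V c => thetaSpaceInputOf hHD hI h₁ h₃ degS V c))) d12 d34).Theta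
            V c i Γ' ∧
        (ballOf hHD hI h₁ h₃ V c hL).ev Γ' ω' =
          fun x => (ballOf hHD hI h₁ h₃ V c hL).J γ x *ᵥ (ballOf hHD hI h₁ h₃ V c hL).ev Γ ω (γ • x) :=
  fun γ _ i Γ ω hω => transl_of_collapse _ V c (theta_thetaModelOf_degS_eq hHD hI h₁ h₃ h emb cover wm d12 d34 V c)
    _ (ballOf_ev_zero hHD hI h₁ h₃ V c hL) γ i Γ ω hω


-- port_pkg: scope closed for this part
end PinCollapse
end Sanity
end Model
end HodgeCM
end
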